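import Summits.Ventures.GridStability.Models.Chiang3PolytopeRoa
import Summits.Ventures.GridStability.Models.ClassicalSwingLosslessEnergy
import HarnessLib

/-!
# GridStability/Models/InfBusLosslessEnergy — the classical transient energy function of model-1's
# `(n+1)`-node model (`ClassicalSwing.energy` of `RecastData.toModel`, node `0` = the bus) IS lit-6's
# printed energy of the `n`-machine + bus reading `toLosslessInf` up to the constant `U(θˢ)`; hence ★ #93's
# work form and the CHIANG3 polytope well in model-1's own energy: `{θ ∈ 𝒫(θˢ), E(δ, ω) ≤ 9/10}`

Venture GRIDFUSION (LADDER-GRIDFUSION G3 model row → G1.a′/G2), cell `run/shared/lean/pub/gridfusion/`,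
seat gridfusion-model-1 (g7), LOW default work (third file of «CS-INFBUS-DICHOTOMY» / «CHIANG3-POLYTOPE»;
parents `Models/InfBusLosslessDichotomy.lean`, `Models/Chiang3PolytopeRoa.lean`). Companion of
`ClassicalSwingLosslessEnergy.toLossless_energy` (p545620, isolated network `m = 0`). NO new analysis.

CONTENTS:
* `RecastData.sum_filter_lt_succ` — bookkeeping: a line sum `Σ_{i<j}` over `Fin (n+1)` splits into the
  bus row `Σ_j g(0, j+1)` and the machine lines `Σ_{i<j} g(i+1, j+1)`;
* `RecastData.toModel_energy_eq_infBus` — THE IDENTITY: for lossless reciprocal data, a reference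
  configuration `θ` with `θ 0 = δ₀` and a state `x` with the bus at `(δ₀, 0)`,
  `toModel.energy θ x = V(machineProj x) − U(machines of θ)` (`V`, `U` = lit-6's `energy`, `potential` of
  `toLosslessInf δ₀`);
* `RecastData.infBus_dichotomy_energy` — ★ #93 §5 with a bus, alternative (a) stated with model-1's typed
  energy: along an infinite-bus solution `E(δ, ω) → −∞` and `Σ P′_iδ_i → +∞`, OR finite energy limit, all
  machine `ω_i → 0`, all mismatches `→ 0`;
* `Chiang3.eq_thetaEq_of_isEquilibrium` — `θˢ` is the ONLY machine rest configuration in the polytope (lit-6's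
  `eq_of_isEquilibrium_of_mem_vtPolytope` by name);
* `Chiang3.polytope_roa_energy` — «CHIANG3-POLYTOPE» with the level in model-1's energy: initial machine
  angles in `𝒫(θˢ)` and `E ≤ 9/10` (E = `Chiang3.data.toModel.energy` relative to the equilibrium
  `angleOf + δ₀`) ⇒ `𝒫`-membership and `E ≤ 9/10` for all `t ≥ 0` and `(δ₁, δ₂, ω₁, ω₂) → (α₁ + δ₀, α₂ + δ₀, 0, 0)`.

THREE COLUMNS (never merged). CERTIFIED (kernel, standard axioms): the identity and the two restatements,
about MODEL `M_cl`+bus (model-1's `n`-machine–infinite-bus classical model, transfer conductances NEGLECTED;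
CHIANG3: MV-2L+MV-P). VALIDATED: nothing. MODELLED: as the parents; inner estimate; nothing here says a grid
is stable. No definition, no named fact, no `sorry`, no kit.
-/

noncomputable section

open Real Set Filter Finset
open scoped Topology
open Literature.MathematicalPhysics.PowerSystems.ClassicalModel

namespace Summit.Ventures.GridStability.Models

namespace RecastData

open InfBus

variable {n : ℕ} (d : RecastData n)

/-- Bookkeeping: a sum over the lines `i < j` of `Fin (n+1)` = the bus row (`i = 0`) + the machine lines
(both indices successors). [folklore] -/
theorem sum_filter_lt_succ (g : Fin (n + 1) → Fin (n + 1) → ℝ) :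
    ∑ i : Fin (n + 1), ∑ j ∈ univ.filter (fun j => i < j), g i j =
      ∑ j : Fin n, g 0 j.succ + ∑ i : Fin n, ∑ j ∈ univ.filter (fun j => i < j), g i.succ j.succ := by
  rw [Fin.sum_univ_succ]
  congr 1
  · rw [Finset.sum_filter, Fin.sum_univ_succ, if_neg (lt_irrefl _), zero_add]
    exact Finset.sum_congr rfl fun j _ => if_pos (Fin.succ_pos j)
  · refine Finset.sum_congr rfl fun i _ => ?_
    rw [Finset.sum_filter, Finset.sum_filter, Fin.sum_univ_succ, if_neg (not_lt.2 (Fin.zero_le _)), zero_add]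
    exact Finset.sum_congr rfl fun j _ => by simp only [Fin.succ_lt_succ_iff]

/-- **The typed classical energy function of the `(n+1)`-node model IS lit-6's energy of the machines-plus-bus
reading, up to the constant `U(θˢ)`.** Lossless reciprocal data; reference configuration `θ` with the bus
at `θ 0 = δ₀`; state `x` with bus angle `δ₀` and bus speed deviation `0`:
`toModel.energy θ x = V(machineProj x) − U(i ↦ θ i.succ)`.
[cite: SauerPai1998, §9.6.2 eq. (9.35), §9.5; VuTuritsyn2016, §III (energy function display)] -/
theorem toModel_energy_eq_infBus (hB : ∀ i j, d.B i j = d.B j i) {δ₀ : ℝ} {θ : Fin (n + 1) → ℝ}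
    (hθ : θ 0 = δ₀) {x : ClassicalSwing.State (n + 1)} (h1 : x.1 0 = δ₀) (h2 : x.2 0 = 0) :
    d.toModel.energy θ x = (d.toLosslessInf δ₀).energy (machineProj x) -
      (d.toLosslessInf δ₀).potential (fun i => θ i.succ) := by
  classical
  set S := d.toLosslessInf δ₀ with hS
  -- the three pieces of model-1's energy, bus row peeled off
  have hK : (∑ i : Fin (n + 1), d.toModel.M i * x.2 i ^ 2) / 2 = ∑ i : Fin n, S.M i / 2 * x.2 i.succ ^ 2 := by
    rw [Fin.sum_univ_succ, h2]
    have h0 : d.toModel.M 0 * (0 : ℝ) ^ 2 = 0 := by ring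
    rw [h0, zero_add, Finset.sum_div]
    exact Finset.sum_congr rfl fun i _ => by simp only [hS, toLosslessInf, toModel]; ring
  have hP : ∑ i : Fin (n + 1), (d.toModel.P i - d.toModel.E i ^ 2 * d.toModel.G i i) * (x.1 i - θ i) =
      ∑ i : Fin n, S.P i * x.1 i.succ - ∑ i : Fin n, S.P i * θ i.succ := by
    rw [Fin.sum_univ_succ, h1, hθ, sub_self, mul_zero, zero_add, ← Finset.sum_sub_distrib]
    exact Finset.sum_congr rfl fun i _ => by simp only [hS, toLosslessInf, toModel]; ring
  have hCc : ∀ a b : Fin (n + 1), d.toModel.Ccoef a b = ((d.Cc a b : ℚ) : ℝ) := d.toModel_Ccoef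
  have hCsym : ∀ a b : Fin (n + 1), ((d.Cc a b : ℚ) : ℝ) = ((d.Cc b a : ℚ) : ℝ) := fun a b => by
    simp only [Cc, hB a b]; push_cast; ring
  -- lit-6's double sums as line sums
  have hoff : ∀ φ : Fin n → ℝ, ∑ i, ∑ j, S.C i j * cos (φ i - φ j) =
      2 * ∑ i : Fin n, ∑ j ∈ univ.filter (fun j => i < j), ((d.Cc i.succ j.succ : ℚ) : ℝ) * cos (φ i - φ j) := by
    intro φ
    have h1 : ∑ i, ∑ j, S.C i j * cos (φ i - φ j) =
        ∑ i, ∑ j ∈ univ.erase i, ((d.Cc i.succ j.succ : ℚ) : ℝ) * cos (φ i - φ j) := by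
      refine Finset.sum_congr rfl fun i _ => ?_
      have hCi : ∀ j, S.C i j = if i = j then (0 : ℝ) else ((d.Cc i.succ j.succ : ℚ) : ℝ) := fun _ => rfl
      rw [← Finset.add_sum_erase univ _ (mem_univ i), hCi, if_pos rfl, zero_mul, zero_add]
      exact Finset.sum_congr rfl fun j hj => by rw [hCi, if_neg (Finset.ne_of_mem_erase hj).symm]
    rw [h1]
    exact ClassicalSwing.sum_erase_eq_two_mul_sum_lt _ fun i j => by
      show ((d.Cc i.succ j.succ : ℚ) : ℝ) * cos (φ i - φ j) = ((d.Cc j.succ i.succ : ℚ) : ℝ) * cos (φ j - φ i)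
      rw [hCsym, ← Real.cos_neg (φ j - φ i), neg_sub]
  have hbus : ∀ φ : Fin n → ℝ, ∑ i, ∑ b : Fin 1, S.K i b * cos (φ i - S.β b) =
      ∑ i : Fin n, ((d.Cc 0 i.succ : ℚ) : ℝ) * cos (δ₀ - φ i) := by
    intro φ
    refine Finset.sum_congr rfl fun i _ => ?_
    rw [Fin.sum_univ_one]
    show ((d.Cc i.succ 0 : ℚ) : ℝ) * cos (φ i - δ₀) = _
    rw [hCsym, ← Real.cos_neg (φ i - δ₀), neg_sub]
  -- model-1's pair sum, bus row peeled off
  have hC := sum_filter_lt_succ (fun i j => d.toModel.Ccoef i j * (cos (x.1 i - x.1 j) - cos (θ i - θ j)))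
  -- assemble
  unfold ClassicalSwing.energy
  rw [hK, hP, hC, LosslessSystem.energy, LosslessSystem.potential, hoff, hoff, hbus, hbus]
  simp only [machineProj_fst, machineProj_snd, hCc, h1, hθ, mul_sub, Finset.sum_sub_distrib, Finset.mul_sum]
  ring

/-- **★ #93 with a bus, work form in model-1's energy.** Lossless reciprocal data, machine `M_i, D_i > 0`:
along every infinite-bus solution on `[0, ∞)` (bus at `δ₀`), for any reference configuration `θ` with
`θ 0 = δ₀`, EITHER the typed classical energy `toModel.energy θ (c t) → −∞` and `Σ_i P′_iδ_{i+1}(t) → +∞`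
(loss of synchronism with the bus) OR the energy converges, every machine `ω_i → 0` and every mismatch
`Pprime_i − P_e,i(δ(t)) → 0`. [cite: Chiang1995, §3 Thm 3.1; Leonov2001, Ch. 4 §4.2 Thm 4.1; VuTuritsyn2016, §III] -/
theorem infBus_dichotomy_energy (hG : ∀ i j, i ≠ j → d.G i j = 0) (hB : ∀ i j, d.B i j = d.B j i)
    (hM : ∀ i : Fin n, 0 < d.M i.succ) (hD : ∀ i : Fin n, 0 < d.D i.succ) {δ₀ : ℝ}
    {θ : Fin (n + 1) → ℝ} (hθ : θ 0 = δ₀)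
    {c : ℝ → ClassicalSwing.State (n + 1)} (hc : d.IsInfBusSolutionOn δ₀ c (Ici 0)) :
    (Tendsto (fun t => d.toModel.energy θ (c t)) atTop atBot ∧
        Tendsto (fun t => ∑ i : Fin n, ((d.Pprime i.succ - d.E i.succ ^ 2 * d.G i.succ i.succ : ℚ) : ℝ) *
          (c t).1 i.succ) atTop atTop) ∨
      ((∃ e : ℝ, Tendsto (fun t => d.toModel.energy θ (c t)) atTop (𝓝 e)) ∧
        (∀ i : Fin n, Tendsto (fun t => (c t).2 i.succ) atTop (𝓝 0)) ∧
        ∀ i : Fin n, Tendsto (fun t => (d.Pprime i.succ : ℝ) - d.toModel.Pe (c t).1 i.succ) atTop (𝓝 0)) := by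
  have hE : ∀ t, 0 ≤ t → d.toModel.energy θ (c t) =
      (d.toLosslessInf δ₀).energy (machineProj (c t)) + (-(d.toLosslessInf δ₀).potential (fun i => θ i.succ)) :=
    fun t ht => by rw [d.toModel_energy_eq_infBus hB hθ (hc t ht).1 (hc t ht).2.1]; ring
  have hcongr : (fun t => d.toModel.energy θ (c t)) =ᶠ[atTop]
      fun t => (d.toLosslessInf δ₀).energy (machineProj (c t)) + (-(d.toLosslessInf δ₀).potential (fun i => θ i.succ)) := by
    filter_upwards [eventually_ge_atTop 0] with t ht using hE t ht
  rcases d.infBus_dichotomy hG hB hM hD hc with ⟨hbot, hwork⟩ | ⟨⟨e, he⟩, hω, hmis⟩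
  · refine Or.inl ⟨?_, hwork⟩
    exact (tendsto_atBot_add_const_right _ _ hbot).congr' hcongr.symm
  · refine Or.inr ⟨⟨e + -(d.toLosslessInf δ₀).potential (fun i => θ i.succ), ?_⟩, hω, hmis⟩
    exact (he.add_const _).congr' hcongr.symm

end RecastData

namespace Chiang3

open InfBus RecastData

/-- **«CHIANG3-POLYTOPE» in model-1's energy.** Bus at `δ₀`; `E` = the typed classical transient energy
function `Chiang3.data.toModel.energy` relative to the equilibrium configuration `angleOf + δ₀`. For every
infinite-bus solution `γ` on `[0, ∞)` with initial machine angles in the polytope (`|(δ₁ − δ₂) + (α₁ − α₂)| < π`,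
`|(δ₁ − δ₀) + α₁| < π`, `|(δ₂ − δ₀) + α₂| < π`) and `E(γ 0) ≤ 9/10`: the three inequalities and `E ≤ 9/10` hold
for all `t ≥ 0` and `(δ₁, δ₂, ω₁, ω₂)(t) → (α₁ + δ₀, α₂ + δ₀, 0, 0)`. Inner estimate, solver-free.
[cite: VuTuritsyn2016, §IV, Appendix 9.2–9.3; RoucheHabetsLaloy1977, Ch. II Thm 1.3] -/
theorem polytope_roa_energy (δ₀ : ℝ) {γ : ℝ → ClassicalSwing.State 3} (hγ : data.IsInfBusSolutionOn δ₀ γ (Ici 0))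
    (hP : |((γ 0).1 1 - (γ 0).1 2) + (alpha 1 - alpha 2)| < π ∧ |((γ 0).1 1 - δ₀) + alpha 1| < π ∧
      |((γ 0).1 2 - δ₀) + alpha 2| < π)
    (hE : data.toModel.energy (fun k => data.angleOf k + δ₀) (γ 0) ≤ 9 / 10) :
    (∀ t, 0 ≤ t →
      (|((γ t).1 1 - (γ t).1 2) + (alpha 1 - alpha 2)| < π ∧ |((γ t).1 1 - δ₀) + alpha 1| < π ∧
        |((γ t).1 2 - δ₀) + alpha 2| < π) ∧
      data.toModel.energy (fun k => data.angleOf k + δ₀) (γ t) ≤ 9 / 10) ∧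
    Tendsto (fun t => (γ t).1 1) atTop (𝓝 (alpha 1 + δ₀)) ∧ Tendsto (fun t => (γ t).1 2) atTop (𝓝 (alpha 2 + δ₀)) ∧
    Tendsto (fun t => (γ t).2 1) atTop (𝓝 0) ∧ Tendsto (fun t => (γ t).2 2) atTop (𝓝 0) := by
  have hθ : (fun k => data.angleOf k + δ₀) 0 = δ₀ := by
    show data.angleOf 0 + δ₀ = δ₀
    rw [show data.angleOf 0 = 0 from alpha_zero, zero_add]
  have hid : ∀ t, 0 ≤ t → data.toModel.energy (fun k => data.angleOf k + δ₀) (γ t) =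
      (data.toLosslessInf δ₀).energy (machineProj (γ t)) - (data.toLosslessInf δ₀).potential (thetaEq δ₀) :=
    fun t ht => data.toModel_energy_eq_infBus (fun a b => data_B_reciprocal b a) hθ (hγ t ht).1 (hγ t ht).2.1
  have hV : (data.toLosslessInf δ₀).energy (machineProj (γ 0)) ≤
      (data.toLosslessInf δ₀).potential (thetaEq δ₀) + 9 / 10 := by
    have h := hid 0 le_rfl
    linarith
  obtain ⟨hall, hlim⟩ := polytope_roa δ₀ hγ hP hV
  refine ⟨fun t ht => ⟨(hall t ht).1, ?_⟩, hlim⟩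
  rw [hid t ht]
  linarith [(hall t ht).2]

/-- **CHIANG3 — `θˢ` is the ONLY rest configuration of the machines in the polytope** (lit-6's
`eq_of_isEquilibrium_of_mem_vtPolytope` BY NAME: pairing identity + strict sector bound, network connected
through the bus): if `θ = (θ₁, θ₂)` satisfies the three polytope inequalities and the power balance of the
record with the bus at `δ₀` (`P′_i = Σ_j C_ij sin(θ_i − θ_j) + K_i sin(θ_i − δ₀)`, i.e. model-1's
`P_e,i(θ) = Pprime_i` at both machines), then `θ = (α₁ + δ₀, α₂ + δ₀)`.
[cite: DorflerChertkovBullo2013, SI §3.1 Lemma 2; VuTuritsyn2016, §IV] -/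
theorem eq_thetaEq_of_isEquilibrium (δ₀ : ℝ) {θ : Fin 2 → ℝ}
    (hP : |(θ 0 - θ 1) + (alpha 1 - alpha 2)| < π ∧ |(θ 0 - δ₀) + alpha 1| < π ∧ |(θ 1 - δ₀) + alpha 2| < π)
    (he : (data.toLosslessInf δ₀).IsEquilibrium θ) : θ = thetaEq δ₀ := by
  set S := data.toLosslessInf δ₀ with hSdef
  have hCnn : ∀ i j, i ≠ j → 0 ≤ S.C i j := fun i j hij => by
    show (0 : ℝ) ≤ (if i = j then (0 : ℝ) else ((data.Cc i.succ j.succ : ℚ) : ℝ))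
    rw [if_neg hij]; exact_mod_cast data_Cc_nonneg _ _
  have hKnn : ∀ i b, 0 ≤ S.K i b := fun i b => by
    show (0 : ℝ) ≤ ((data.Cc i.succ 0 : ℚ) : ℝ); exact_mod_cast data_Cc_nonneg _ _
  have hcoh : ∀ i j, S.C i j ≠ 0 → |thetaEq δ₀ i - thetaEq δ₀ j| < π / 2 := fun i j _ => by
    have h : thetaEq δ₀ i - thetaEq δ₀ j = data.angleOf i.succ - data.angleOf j.succ := by
      simp only [thetaEq]; ring
    rw [h]
    exact data.abs_angleOf_sub_lt_pi_div_two (data_s_nonneg _) (data_s_nonneg _) (data_c_pos _) (data_c_pos _)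
  have hcohb : ∀ i b, S.K i b ≠ 0 → |thetaEq δ₀ i - S.β b| < π / 2 := fun i b _ => by
    have h : thetaEq δ₀ i - S.β b = data.angleOf i.succ := by
      show data.angleOf i.succ + δ₀ - δ₀ = _; ring
    rw [h]
    exact data.abs_angleOf_lt_pi_div_two (data_c_pos _)
  exact S.eq_of_isEquilibrium_of_mem_vtPolytope (data.toLosslessInf_C_symm (fun a b => data_B_reciprocal b a) δ₀) hCnn hKnn
    (couplingConnectedToBus δ₀) (isEquilibrium_thetaEq δ₀) hcoh hcohb ((mem_vtPolytope_iff δ₀ θ).2 hP) he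

end Chiang3

end Summit.Ventures.GridStability.Models
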